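import Summits.NavierStokesRegularity.NavierStokesRegularity.Theorems.OddMorawetzMorawetzKillsTypeIJetCoordDefs
import Summits.NavierStokesRegularity.NavierStokesRegularity.Theorems.OddMorawetzMorawetzKillsTypeICubicJetExpansion

/-!
# Crux `OddMorawetz.MorawetzKillsTypeI` — stub `stub_kitSums` (generic algebra for the structure theorems, I)

Elementary finite-dimensional bookkeeping used (thousands of times, by generated files) in the isotropy cut of
the crux `Summit.NavierStokesRegularity.NavierStokesRegularity.Theses.OddMorawetz.MorawetzKillsTypeI`
(item `stmt-NavierStokesRegularity-1377`, line `registered`), where an invariant trilinear form `T = D³m(0)` on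
3-jets `Jet3 = ℝ³ × L(ℝ³; ℝ³) × L²(ℝ³; ℝ³) × L³(ℝ³; ℝ³)` is expanded on pure basis jets:

* (K1) `KitSums.tri_sum`: a continuous trilinear form commutes with finite sums in each of its three slots
  (`MultilinearMap.map_update_sum`, after identifying `![x, y, w]` with a `Function.update` of a fixed family);
* (K2) `KitSums.sum_symm₂`: for a symmetric `g : Fin n → Fin n → ℝ`,
  `∑ a b, g a b = ∑ a, g a a + 2 ∑_{a<b} g a b`;
* (K3) `KitSums.sum_symm₃`: for a fully symmetric `g : Fin n → Fin n → Fin n → ℝ`,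
  `∑ a b c, g a b c = ∑ a, g a a a + 3 ∑_{a<b} (g a a b + g a b b) + 6 ∑_{a<b<c} g a b c`
  (pointwise trichotomy splitting of the summands, `Finset.sum_comm`, `Finset.sum_ite_eq'`);
* (K4) `KitSums.embed_sum`: the four pure-jet embeddings `X ↦ (X,0,0,0), (0,X,0,0), …` are linear, hence pass
  through finite linear combinations (they are `LinearMap.inl` / `LinearMap.inr` composites);
* (K8) `KitSums.generator_pure`: the infinitesimal generator
  `ℓ z = (L z₀, L ∘ z₁ - z₁ ∘₁ L, L ∘ z₂ - ∑ₛ z₂ ∘ₛ L, L ∘ z₃ - ∑ₛ z₃ ∘ₛ L)` of the jet action (any linear `L`)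
  evaluated on pure jets;
* (K9) `KitSums.toEuclideanCLM_single`: `(Matrix.toEuclideanCLM M) e_j` has `i`-th coordinate `M i j`;
* (K10) `KitSums.sum_pi_fin_one/two/three`: sums over `Fin n → Fin 3` (`n = 1, 2, 3`) as iterated sums over
  the literal tuples `![j]`, `![j₀, j₁]`, `![j₀, j₁, j₂]` (`Fin.consEquiv`, `Fintype.sum_prod_type'`).

The registered statement `stub_kitSums` is the conjunction of these.  Mathlib only (plus the tree's `Jet3`, `E3`).
-/

noncomputable section

set_option linter.dupNamespace false

namespace Summit.NavierStokesRegularity.NavierStokesRegularity.Theorems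

open Summit.NavierStokesRegularity.NavierStokesRegularity.Theorems.OddMorawetz

namespace KitSums

/-! ### (K1) Slotwise finite sums of a trilinear form on jets -/

/-- `![v, y, w]` as an update of the first slot. -/
theorem vec3_update₀ (v y w : Jet3) : Function.update ![(0 : Jet3), y, w] 0 v = ![v, y, w] := by
  funext k; fin_cases k <;> rfl

/-- `![y, v, w]` as an update of the second slot. -/
theorem vec3_update₁ (v y w : Jet3) : Function.update ![y, (0 : Jet3), w] 1 v = ![y, v, w] := by
  funext k; fin_cases k <;> rfl

/-- `![y, w, v]` as an update of the third slot. -/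
theorem vec3_update₂ (v y w : Jet3) : Function.update ![y, w, (0 : Jet3)] 2 v = ![y, w, v] := by
  funext k; fin_cases k <;> rfl

/-- A continuous trilinear form commutes with finite sums in an updated slot. -/
theorem map_update_sum (T : Jet3 [×3]→L[ℝ] ℝ) {ι : Type} (s : Finset ι) (x : ι → Jet3) (m : Fin 3 → Jet3)
    (k : Fin 3) : T (Function.update m k (∑ i ∈ s, x i)) = ∑ i ∈ s, T (Function.update m k (x i)) :=
  T.toMultilinearMap.map_update_sum s k x m

/-- **(K1)** A continuous trilinear form on jets commutes with finite sums in each of its three slots. -/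
theorem tri_sum (T : Jet3 [×3]→L[ℝ] ℝ) {ι : Type} (s : Finset ι) (x : ι → Jet3) (y w : Jet3) :
    T ![∑ i ∈ s, x i, y, w] = ∑ i ∈ s, T ![x i, y, w] ∧ T ![y, ∑ i ∈ s, x i, w] = ∑ i ∈ s, T ![y, x i, w] ∧
      T ![y, w, ∑ i ∈ s, x i] = ∑ i ∈ s, T ![y, w, x i] := by
  refine ⟨?_, ?_, ?_⟩
  · rw [← vec3_update₀ (∑ i ∈ s, x i) y w, map_update_sum]
    simp only [vec3_update₀]
  · rw [← vec3_update₁ (∑ i ∈ s, x i) y w, map_update_sum]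
    simp only [vec3_update₁]
  · rw [← vec3_update₂ (∑ i ∈ s, x i) y w, map_update_sum]
    simp only [vec3_update₂]

/-! ### (K2), (K3) Folding symmetric double and triple sums over `Fin n` -/

/-- **(K2)** Folding a symmetric double sum: `∑ a b, g a b = ∑ a, g a a + 2 ∑_{a<b} g a b`. -/
theorem sum_symm₂ (n : ℕ) (g : Fin n → Fin n → ℝ) (h : ∀ a b, g a b = g b a) :
    ∑ a, ∑ b, g a b = ∑ a, g a a + 2 * ∑ a, ∑ b, if a < b then g a b else 0 := by
  have hsplit : ∀ a b, g a b =
      (if a < b then g a b else 0) + (if b < a then g b a else 0) + (if b = a then g a a else 0) := by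
    intro a b
    rcases lt_trichotomy a b with hab | rfl | hab
    · simp [hab, lt_asymm hab, (ne_of_lt hab).symm]
    · simp
    · simp [hab, lt_asymm hab, ne_of_lt hab, h a b]
  have hlow : (∑ a, ∑ b, if b < a then g b a else 0) = ∑ a, ∑ b, if a < b then g a b else 0 :=
    Finset.sum_comm
  calc ∑ a, ∑ b, g a b
      = ∑ a, ∑ b, ((if a < b then g a b else 0) + (if b < a then g b a else 0) +
          (if b = a then g a a else 0)) :=
        Finset.sum_congr rfl fun a _ => Finset.sum_congr rfl fun b _ => hsplit a b
    _ = (∑ a, ∑ b, if a < b then g a b else 0) + (∑ a, ∑ b, if b < a then g b a else 0) + ∑ a, g a a := by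
        simp only [Finset.sum_add_distrib, Finset.sum_ite_eq', Finset.mem_univ, if_true]
    _ = ∑ a, g a a + 2 * ∑ a, ∑ b, if a < b then g a b else 0 := by rw [hlow]; ring

/-- **(K3)** Folding a fully symmetric triple sum:
`∑ a b c, g a b c = ∑ a, g a a a + 3 ∑_{a<b} (g a a b + g a b b) + 6 ∑_{a<b<c} g a b c`. -/
theorem sum_symm₃ (n : ℕ) (g : Fin n → Fin n → Fin n → ℝ) (h₁ : ∀ a b c, g a b c = g b a c)
    (h₂ : ∀ a b c, g a b c = g a c b) :
    ∑ a, ∑ b, ∑ c, g a b c = ∑ a, g a a a + 3 * (∑ a, ∑ b, if a < b then g a a b + g a b b else 0) +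
      6 * ∑ a, ∑ b, ∑ c, if a < b ∧ b < c then g a b c else 0 := by
  -- the inner double sum is symmetric: fold it with (K2)
  have step1 : ∑ a, ∑ b, ∑ c, g a b c =
      ∑ a, ∑ b, g a b b + 2 * ∑ a, ∑ b, ∑ c, if b < c then g a b c else 0 := by
    rw [Finset.mul_sum, ← Finset.sum_add_distrib]
    exact Finset.sum_congr rfl fun a _ => sum_symm₂ n (g a) (h₂ a)
  -- the diagonal double sum `∑ a b, g a b b`
  have hsplit₂ : ∀ a b, g a b b =
      (if a < b then g a b b else 0) + (if b < a then g b b a else 0) + (if b = a then g a a a else 0) := by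
    intro a b
    rcases lt_trichotomy a b with hab | rfl | hab
    · simp [hab, lt_asymm hab, (ne_of_lt hab).symm]
    · simp
    · simp [hab, lt_asymm hab, ne_of_lt hab, (h₁ a b b).trans (h₂ b a b)]
  have step2 : ∑ a, ∑ b, g a b b = (∑ a, ∑ b, if a < b then g a b b else 0) +
      (∑ a, ∑ b, if a < b then g a a b else 0) + ∑ a, g a a a := by
    have hlow : (∑ a, ∑ b, if b < a then g b b a else 0) = ∑ a, ∑ b, if a < b then g a a b else 0 :=
      Finset.sum_comm
    rw [← hlow]
    calc ∑ a, ∑ b, g a b b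
        = ∑ a, ∑ b, ((if a < b then g a b b else 0) + (if b < a then g b b a else 0) +
            (if b = a then g a a a else 0)) :=
          Finset.sum_congr rfl fun a _ => Finset.sum_congr rfl fun b _ => hsplit₂ a b
      _ = _ := by simp only [Finset.sum_add_distrib, Finset.sum_ite_eq', Finset.mem_univ, if_true]
  -- the off-diagonal triple sum `∑ a, ∑_{b<c} g a b c`: position of `a` relative to `b < c`
  have key : ∀ a b c : Fin n, (if b < c then g a b c else 0) =
      (if a < b ∧ b < c then g a b c else 0) +
      (if b = a then (if b < c then g b b c else 0) else 0) +
      (if b < a ∧ a < c then g b a c else 0) +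
      (if c = a then (if b < c then g b c c else 0) else 0) +
      (if b < c ∧ c < a then g b c a else 0) := by
    intro a b c
    by_cases hbc : b < c
    · rcases lt_trichotomy a b with hab | rfl | hab
      · have hac : a < c := hab.trans hbc
        simp [hbc, hab, lt_asymm hab, (ne_of_lt hab).symm, lt_asymm hac, (ne_of_lt hac).symm]
      · simp [hbc, lt_asymm hbc, (ne_of_lt hbc).symm]
      · rcases lt_trichotomy a c with hac | rfl | hac
        · simp [hbc, hab, hac, lt_asymm hab, ne_of_lt hab, lt_asymm hac, (ne_of_lt hac).symm, h₁ a b c]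
        · simp [hab, lt_asymm hab, ne_of_lt hab, h₁ a b a]
        · simp [hbc, hab, hac, lt_asymm hab, ne_of_lt hab, lt_asymm hac, ne_of_lt hac,
            (h₁ a b c).trans (h₂ b a c)]
    · have h3 : ¬(b < a ∧ a < c) := fun hh => hbc (hh.1.trans hh.2)
      simp [hbc, h3]
  have step3 : (∑ a, ∑ b, ∑ c, if b < c then g a b c else 0) =
      (∑ a, ∑ b, ∑ c, if a < b ∧ b < c then g a b c else 0) +
      (∑ a, ∑ b, ∑ c, if b = a then (if b < c then g b b c else 0) else 0) +
      (∑ a, ∑ b, ∑ c, if b < a ∧ a < c then g b a c else 0) +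
      (∑ a, ∑ b, ∑ c, if c = a then (if b < c then g b c c else 0) else 0) +
      (∑ a, ∑ b, ∑ c, if b < c ∧ c < a then g b c a else 0) := by
    simp only [← Finset.sum_add_distrib]
    exact Finset.sum_congr rfl fun a _ => Finset.sum_congr rfl fun b _ =>
      Finset.sum_congr rfl fun c _ => key a b c
  have e2 : (∑ a, ∑ b, ∑ c, if b = a then (if b < c then g b b c else 0) else (0 : ℝ)) =
      ∑ a, ∑ b, if a < b then g a a b else 0 := by
    refine Finset.sum_congr rfl fun a _ => ?_
    rw [Finset.sum_comm]
    simp only [Finset.sum_ite_eq', Finset.mem_univ, if_true]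
  have e3 : (∑ a, ∑ b, ∑ c, if b < a ∧ a < c then g b a c else (0 : ℝ)) =
      ∑ a, ∑ b, ∑ c, if a < b ∧ b < c then g a b c else 0 := Finset.sum_comm
  have e4 : (∑ a, ∑ b, ∑ c, if c = a then (if b < c then g b c c else 0) else (0 : ℝ)) =
      ∑ a, ∑ b, if a < b then g a b b else 0 := by
    simp only [Finset.sum_ite_eq', Finset.mem_univ, if_true]
    exact Finset.sum_comm
  have e5 : (∑ a, ∑ b, ∑ c, if b < c ∧ c < a then g b c a else (0 : ℝ)) =
      ∑ a, ∑ b, ∑ c, if a < b ∧ b < c then g a b c else 0 := by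
    rw [Finset.sum_comm]
    exact Finset.sum_congr rfl fun b _ => Finset.sum_comm
  have hM : (∑ a, ∑ b, if a < b then g a a b + g a b b else 0) =
      (∑ a, ∑ b, if a < b then g a a b else 0) + ∑ a, ∑ b, if a < b then g a b b else 0 := by
    rw [← Finset.sum_add_distrib]
    refine Finset.sum_congr rfl fun a _ => ?_
    rw [← Finset.sum_add_distrib]
    refine Finset.sum_congr rfl fun b _ => ?_
    rw [ite_add_ite, add_zero]
  rw [step1, step2, step3, e2, e3, e4, e5, hM]
  ring

/-! ### (K4) Linearity of the pure-jet embeddings -/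

/-- **(K4)** The four pure-jet embeddings pass through finite linear combinations. -/
theorem embed_sum {ι : Type} (s : Finset ι) (c : ι → ℝ) :
    (∀ (X : ι → E3), (((∑ i ∈ s, c i • X i), 0, 0, 0) : Jet3) = ∑ i ∈ s, c i • ((X i, 0, 0, 0) : Jet3)) ∧
    (∀ (X : ι → E3 [×1]→L[ℝ] E3),
      ((0, (∑ i ∈ s, c i • X i), 0, 0) : Jet3) = ∑ i ∈ s, c i • ((0, X i, 0, 0) : Jet3)) ∧
    (∀ (X : ι → E3 [×2]→L[ℝ] E3),
      ((0, 0, (∑ i ∈ s, c i • X i), 0) : Jet3) = ∑ i ∈ s, c i • ((0, 0, X i, 0) : Jet3)) ∧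
    (∀ (X : ι → E3 [×3]→L[ℝ] E3),
      ((0, 0, 0, (∑ i ∈ s, c i • X i)) : Jet3) = ∑ i ∈ s, c i • ((0, 0, 0, X i) : Jet3)) := by
  refine ⟨fun X => ?_, fun X => ?_, fun X => ?_, fun X => ?_⟩
  · have hE : ∀ v : E3, ((v, 0, 0, 0) : Jet3) =
        LinearMap.inl ℝ E3 ((E3 [×1]→L[ℝ] E3) × (E3 [×2]→L[ℝ] E3) × (E3 [×3]→L[ℝ] E3)) v := fun v => rfl
    simp only [hE, map_sum, map_smul]
  · have hE : ∀ v : E3 [×1]→L[ℝ] E3, ((0, v, 0, 0) : Jet3) =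
        (LinearMap.inr ℝ E3 ((E3 [×1]→L[ℝ] E3) × (E3 [×2]→L[ℝ] E3) × (E3 [×3]→L[ℝ] E3)) ∘ₗ
          LinearMap.inl ℝ (E3 [×1]→L[ℝ] E3) ((E3 [×2]→L[ℝ] E3) × (E3 [×3]→L[ℝ] E3))) v := fun v => rfl
    simp only [hE, map_sum, map_smul]
  · have hE : ∀ v : E3 [×2]→L[ℝ] E3, ((0, 0, v, 0) : Jet3) =
        (LinearMap.inr ℝ E3 ((E3 [×1]→L[ℝ] E3) × (E3 [×2]→L[ℝ] E3) × (E3 [×3]→L[ℝ] E3)) ∘ₗ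
          LinearMap.inr ℝ (E3 [×1]→L[ℝ] E3) ((E3 [×2]→L[ℝ] E3) × (E3 [×3]→L[ℝ] E3)) ∘ₗ
            LinearMap.inl ℝ (E3 [×2]→L[ℝ] E3) (E3 [×3]→L[ℝ] E3)) v := fun v => rfl
    simp only [hE, map_sum, map_smul]
  · have hE : ∀ v : E3 [×3]→L[ℝ] E3, ((0, 0, 0, v) : Jet3) =
        (LinearMap.inr ℝ E3 ((E3 [×1]→L[ℝ] E3) × (E3 [×2]→L[ℝ] E3) × (E3 [×3]→L[ℝ] E3)) ∘ₗ
          LinearMap.inr ℝ (E3 [×1]→L[ℝ] E3) ((E3 [×2]→L[ℝ] E3) × (E3 [×3]→L[ℝ] E3)) ∘ₗ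
            LinearMap.inr ℝ (E3 [×2]→L[ℝ] E3) (E3 [×3]→L[ℝ] E3)) v := fun v => rfl
    simp only [hE, map_sum, map_smul]

/-! ### (K8) The infinitesimal generator on pure jets -/

/-- `L ∘ 0 = 0` for the composition of a continuous linear map with the zero multilinear map. -/
theorem compContinuousMultilinearMap_zero (L : E3 →L[ℝ] E3) (n : ℕ) :
    L.compContinuousMultilinearMap (0 : E3 [×n]→L[ℝ] E3) = 0 := by
  ext h i
  simp

/-- `0 ∘ (f₁, …, fₙ) = 0` for the zero multilinear map precomposed with continuous linear maps. -/
theorem zero_compContinuousLinearMap (n : ℕ) (f : Fin n → E3 →L[ℝ] E3) :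
    (0 : E3 [×n]→L[ℝ] E3).compContinuousLinearMap f = 0 := by
  ext h i
  simp

/-- **(K8)** The infinitesimal generator `ℓ` of the jet action (for an arbitrary linear `L`) on pure jets. -/
theorem generator_pure (L : E3 →L[ℝ] E3) :
    let ℓ : Jet3 → Jet3 := fun z =>
      (L z.1,
        L.compContinuousMultilinearMap z.2.1 -
          ∑ s : Fin 1, z.2.1.compContinuousLinearMap (Function.update (fun _ => ContinuousLinearMap.id ℝ E3) s L),
        L.compContinuousMultilinearMap z.2.2.1 -
          ∑ s : Fin 2, z.2.2.1.compContinuousLinearMap (Function.update (fun _ => ContinuousLinearMap.id ℝ E3) s L),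
        L.compContinuousMultilinearMap z.2.2.2 -
          ∑ s : Fin 3, z.2.2.2.compContinuousLinearMap (Function.update (fun _ => ContinuousLinearMap.id ℝ E3) s L));
    (∀ x : E3, ℓ ((x, 0, 0, 0) : Jet3) = ((L x, 0, 0, 0) : Jet3)) ∧
    (∀ X : E3 [×1]→L[ℝ] E3, ℓ ((0, X, 0, 0) : Jet3) = ((0, L.compContinuousMultilinearMap X -
          ∑ s : Fin 1, X.compContinuousLinearMap (Function.update (fun _ => ContinuousLinearMap.id ℝ E3) s L), 0, 0) : Jet3)) ∧
    (∀ X : E3 [×2]→L[ℝ] E3, ℓ ((0, 0, X, 0) : Jet3) = ((0, 0, L.compContinuousMultilinearMap X -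
          ∑ s : Fin 2, X.compContinuousLinearMap (Function.update (fun _ => ContinuousLinearMap.id ℝ E3) s L), 0) : Jet3)) ∧
    (∀ X : E3 [×3]→L[ℝ] E3, ℓ ((0, 0, 0, X) : Jet3) = ((0, 0, 0, L.compContinuousMultilinearMap X -
          ∑ s : Fin 3, X.compContinuousLinearMap (Function.update (fun _ => ContinuousLinearMap.id ℝ E3) s L)) : Jet3)) := by
  intro ℓ
  refine ⟨fun x => ?_, fun X => ?_, fun X => ?_, fun X => ?_⟩ <;>
    simp only [ℓ, map_zero, compContinuousMultilinearMap_zero, zero_compContinuousLinearMap,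
      Finset.sum_const_zero, sub_zero]

/-! ### (K9) Matrix entries of `Matrix.toEuclideanCLM` -/

/-- **(K9)** `(Matrix.toEuclideanCLM M) e_j` has `i`-th coordinate `M i j`. -/
theorem toEuclideanCLM_single (M : Matrix (Fin 3) (Fin 3) ℝ) (i j : Fin 3) :
    Matrix.toEuclideanCLM (n := Fin 3) (𝕜 := ℝ) M (EuclideanSpace.single j (1 : ℝ)) i = M i j := by
  rw [Matrix.ofLp_toEuclideanCLM, PiLp.ofLp_single, Matrix.mulVec_single_one]
  rfl

/-! ### (K10) Sums over `Fin n → Fin 3` as iterated sums -/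

/-- Peeling off the first index of a sum over `Fin (n + 1) → Fin 3`. -/
theorem sum_pi_fin_succ {M : Type} [AddCommMonoid M] {n : ℕ} (f : (Fin (n + 1) → Fin 3) → M) :
    ∑ J, f J = ∑ j : Fin 3, ∑ J' : Fin n → Fin 3, f (Matrix.vecCons j J') := by
  rw [← Fintype.sum_prod_type']
  exact (Fintype.sum_equiv (Fin.consEquiv fun _ => Fin 3) (fun p => f (Matrix.vecCons p.1 p.2)) f
    fun _ => rfl).symm

/-- The sum over the one-point type `Fin 0 → Fin 3`. -/
theorem sum_pi_fin_zero {M : Type} [AddCommMonoid M] (f : (Fin 0 → Fin 3) → M) : ∑ J, f J = f ![] := by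
  rw [Fintype.sum_unique]
  exact congrArg f (Subsingleton.elim _ _)

/-- **(K10)**, `n = 1`. -/
theorem sum_pi_fin_one {M : Type} [AddCommMonoid M] (f : (Fin 1 → Fin 3) → M) :
    ∑ J, f J = ∑ j : Fin 3, f ![j] := by
  simp only [sum_pi_fin_succ, sum_pi_fin_zero]

/-- **(K10)**, `n = 2`. -/
theorem sum_pi_fin_two {M : Type} [AddCommMonoid M] (f : (Fin 2 → Fin 3) → M) :
    ∑ J, f J = ∑ j₀ : Fin 3, ∑ j₁ : Fin 3, f ![j₀, j₁] := by
  simp only [sum_pi_fin_succ, sum_pi_fin_zero]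

/-- **(K10)**, `n = 3`. -/
theorem sum_pi_fin_three {M : Type} [AddCommMonoid M] (f : (Fin 3 → Fin 3) → M) :
    ∑ J, f J = ∑ j₀ : Fin 3, ∑ j₁ : Fin 3, ∑ j₂ : Fin 3, f ![j₀, j₁, j₂] := by
  simp only [sum_pi_fin_succ, sum_pi_fin_zero]

end KitSums

/-! ### The registered statement -/

set_option linter.unusedVariables false in
/-- **stub `stub_kitSums` of the crux `OddMorawetz.MorawetzKillsTypeI` (line `registered`). Generic algebra for
the structure theorems, I.** (K1) slotwise finite sums of a trilinear form on jets; (K2)/(K3) folding of symmetric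
double/triple sums over `Fin n` into ordered index ranges; (K4) linearity of the pure-jet embeddings; (K8) the
infinitesimal generator `ℓ` of the jet action (for any linear `L`) on pure jets; (K9) matrix entries of
`Matrix.toEuclideanCLM`; (K10) sums over `Fin n → Fin 3` as iterated sums. (The `let e` of the registered
statement is not referenced by its body, whence the `unusedVariables` linter is switched off for this declaration.) -/
theorem stub_kitSums :
    let e : Fin 3 → E3 := fun i => EuclideanSpace.single i (1 : ℝ);
    (∀ (T : Jet3 [×3]→L[ℝ] ℝ) {ι : Type} (s : Finset ι) (x : ι → Jet3) (y w : Jet3),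
      T ![∑ i ∈ s, x i, y, w] = ∑ i ∈ s, T ![x i, y, w] ∧ T ![y, ∑ i ∈ s, x i, w] = ∑ i ∈ s, T ![y, x i, w] ∧
        T ![y, w, ∑ i ∈ s, x i] = ∑ i ∈ s, T ![y, w, x i]) ∧
    (∀ (n : ℕ) (g : Fin n → Fin n → ℝ), (∀ a b, g a b = g b a) →
      ∑ a, ∑ b, g a b = ∑ a, g a a + 2 * ∑ a, ∑ b, if a < b then g a b else 0) ∧
    (∀ (n : ℕ) (g : Fin n → Fin n → Fin n → ℝ), (∀ a b c, g a b c = g b a c) → (∀ a b c, g a b c = g a c b) →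
      ∑ a, ∑ b, ∑ c, g a b c = ∑ a, g a a a + 3 * (∑ a, ∑ b, if a < b then g a a b + g a b b else 0) +
        6 * ∑ a, ∑ b, ∑ c, if a < b ∧ b < c then g a b c else 0) ∧
    (∀ {ι : Type} (s : Finset ι) (c : ι → ℝ),
      (∀ (X : ι → E3), (((∑ i ∈ s, c i • X i), 0, 0, 0) : Jet3) = ∑ i ∈ s, c i • ((X i, 0, 0, 0) : Jet3)) ∧
      (∀ (X : ι → E3 [×1]→L[ℝ] E3), ((0, (∑ i ∈ s, c i • X i), 0, 0) : Jet3) = ∑ i ∈ s, c i • ((0, X i, 0, 0) : Jet3)) ∧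
      (∀ (X : ι → E3 [×2]→L[ℝ] E3), ((0, 0, (∑ i ∈ s, c i • X i), 0) : Jet3) = ∑ i ∈ s, c i • ((0, 0, X i, 0) : Jet3)) ∧
      (∀ (X : ι → E3 [×3]→L[ℝ] E3), ((0, 0, 0, (∑ i ∈ s, c i • X i)) : Jet3) = ∑ i ∈ s, c i • ((0, 0, 0, X i) : Jet3))) ∧
    (∀ (L : E3 →L[ℝ] E3),
      let ℓ : Jet3 → Jet3 := fun z =>
        (L z.1,
          L.compContinuousMultilinearMap z.2.1 -
            ∑ s : Fin 1, z.2.1.compContinuousLinearMap (Function.update (fun _ => ContinuousLinearMap.id ℝ E3) s L),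
          L.compContinuousMultilinearMap z.2.2.1 -
            ∑ s : Fin 2, z.2.2.1.compContinuousLinearMap (Function.update (fun _ => ContinuousLinearMap.id ℝ E3) s L),
          L.compContinuousMultilinearMap z.2.2.2 -
            ∑ s : Fin 3, z.2.2.2.compContinuousLinearMap (Function.update (fun _ => ContinuousLinearMap.id ℝ E3) s L));
      (∀ x : E3, ℓ ((x, 0, 0, 0) : Jet3) = ((L x, 0, 0, 0) : Jet3)) ∧
      (∀ X : E3 [×1]→L[ℝ] E3, ℓ ((0, X, 0, 0) : Jet3) = ((0, L.compContinuousMultilinearMap X -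
            ∑ s : Fin 1, X.compContinuousLinearMap (Function.update (fun _ => ContinuousLinearMap.id ℝ E3) s L), 0, 0) : Jet3)) ∧
      (∀ X : E3 [×2]→L[ℝ] E3, ℓ ((0, 0, X, 0) : Jet3) = ((0, 0, L.compContinuousMultilinearMap X -
            ∑ s : Fin 2, X.compContinuousLinearMap (Function.update (fun _ => ContinuousLinearMap.id ℝ E3) s L), 0) : Jet3)) ∧
      (∀ X : E3 [×3]→L[ℝ] E3, ℓ ((0, 0, 0, X) : Jet3) = ((0, 0, 0, L.compContinuousMultilinearMap X -
            ∑ s : Fin 3, X.compContinuousLinearMap (Function.update (fun _ => ContinuousLinearMap.id ℝ E3) s L)) : Jet3))) ∧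
    (∀ (M : Matrix (Fin 3) (Fin 3) ℝ) (i j : Fin 3),
      Matrix.toEuclideanCLM (n := Fin 3) (𝕜 := ℝ) M (EuclideanSpace.single j (1 : ℝ)) i = M i j) ∧
    (∀ {M : Type} [AddCommMonoid M],
      (∀ f : (Fin 1 → Fin 3) → M, ∑ J, f J = ∑ j : Fin 3, f ![j]) ∧
      (∀ f : (Fin 2 → Fin 3) → M, ∑ J, f J = ∑ j₀ : Fin 3, ∑ j₁ : Fin 3, f ![j₀, j₁]) ∧
      (∀ f : (Fin 3 → Fin 3) → M, ∑ J, f J = ∑ j₀ : Fin 3, ∑ j₁ : Fin 3, ∑ j₂ : Fin 3, f ![j₀, j₁, j₂])) :=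
  ⟨KitSums.tri_sum, KitSums.sum_symm₂, KitSums.sum_symm₃, KitSums.embed_sum, KitSums.generator_pure,
    KitSums.toEuclideanCLM_single, fun {_} _ => ⟨KitSums.sum_pi_fin_one, KitSums.sum_pi_fin_two,
      KitSums.sum_pi_fin_three⟩⟩

end Summit.NavierStokesRegularity.NavierStokesRegularity.Theorems
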